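import Mathlib
import Literature.Computability.AlgebraicComplexity.NestFreeMatchingPoly
import Literature.Computability.AlgebraicComplexity.ArithCircuitProofs
import Literature.Computability.AlgebraicComplexity.ValiantClassesProofs
import Summits.ValiantsHypothesis.ValiantsHypothesis.Theorems.FifoMatchingNNDivisionHardStackPowersQueue
import HarnessLib

/-!
# Route FifoMatching — crux `NNDivisionHard` (stmt-ValiantsHypothesis-21181): LINEAR-COST TRANSPORT of certificates
# along split faces — partial evaluation at `1` replaces monomial stripping

The transport rungs of `…NNDivisionHardBlockTransport` / `…NNDivisionHardUniversalTransport` restrict a certificate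
`(h, NN_n · h)` to the left block at QUADRATIC cost `16((2n+1)(L+1))²`, paid to the Jukna–Seiwert–Sergeev monomial
stripping.  Here the stripping is replaced by a PROJECTION (Bürgisser 2000, Rem. 2.7: projections are free): after the
top component in the face direction `w` (free over `ℝ≥0`), substitute `1` for every arc variable outside the block.  Over
`ℝ≥0` this kills nothing, fixes the block factor `ι(NN_a)`, collapses the complementary factor of the face to a POSITIVE
CONSTANT, and leaves a cofactor in the block variables only.  Abstractly:

* `eval_one_ne_zero`, `eval_one_aeval_of_X_or_one`, `aeval_ne_zero_of_X_or_one`, `complexity_aeval_le_of_X_or_one`,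
  `vars_aeval_subset`, `aeval_eq_C_of_support`, `aeval_rename_of_kept` — bookkeeping of the substitution
  `x_e ↦ x_e (e kept) / 1 (e not kept)`;
* ★★ `linear_transport` — **ABSTRACT LINEAR TRANSPORT**: if `top_w P = ι(Q) · S` with `ι` an injective renaming, `S ≠ 0`
  and no monomial of `S` touching a variable in the range of `ι`, then for EVERY `h ≠ 0` there is `g ≠ 0` with
  `L₊(Q · g) ≤ L₊(P · h) + 1` and `L₊(g) ≤ L₊(h)`;
* ★★ `exists_transport_linear` — instance `P = NN_n`, `Q = NN_a`, `w` = the pinned rainbow direction, `S = x^{pins}`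
  (face identification `StackPowersQueue.topComponent_eq`): **for `4a+2 ≤ 2n`, `n ≤ 3a+1` and every `h ≠ 0` there is
  `f ≠ 0` on the left block with `L₊(NN_a · f) ≤ L₊(NN_n · h) + 1` and `L₊(f) ≤ L₊(h)`** — the bound of
  `UniversalTransport.exists_transport` improved from `16((2n+1)(L+1))²` to `L + 1`; `exists_transport_linear_third` is the
  canonical block `a = ⌊(n+2)/3⌋`, `n ≥ 7`;
  Since the cost is additive, certificates now restrict along the whole chain `n → ⌊(n+2)/3⌋ → …` (`k` steps cost
  `+k`), which the quadratic rung could not afford.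

HONEST FRAMING: an engine-level self-reduction (scale `n → a`, cost `+1`); by itself not a lower bound.  stmt-21181 stays
OPEN; nothing here bears on `NNNotVP` or on VP ≠ VNP (NOT proved).
References: Bürgisser 2000 Rem. 2.7 [Burgisser2000]; Jukna–Seiwert–Sergeev 2022 Thm 1 [JuknaSeiwertSergeev2022];
Hrubeš–Yehudayoff 2021 §6 Problem 2 [HrubesYehudayoff2021].
-/

noncomputable section

-- Sub = Summit single-conjunct layout: the duplicated namespace component is mandated by the tree.
set_option linter.dupNamespace false
set_option autoImplicit false

namespace Summit.ValiantsHypothesis.ValiantsHypothesis.Theorems.FifoMatching.NNDivisionHard.LinearTransport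

open Finset MvPolynomial Literature.Computability.AlgebraicComplexity
open Summit.ValiantsHypothesis.ValiantsHypothesis.Theorems.ZeroOneTransfer.Negative
  (topComponent topComponent_mul complexity_topComponent_le topComponent_ne_zero)
open Summit.ValiantsHypothesis.ValiantsHypothesis.Theorems.FifoMatching.NNDivisionHard.StackPowersQueue
  (prWeight pinExp pinOpeners pinFin blockEmb blockEmb_injective topComponent_eq)
open scoped NNReal BigOperators

/-! ### §1 Partial evaluation at `1` -/

section PartialEval

variable {σ : Type*}

/-- Over `ℝ≥0` a nonzero polynomial has a nonzero value at the all-ones point (the sum of its coefficients).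
[folklore] -/
theorem eval_one_ne_zero {q : MvPolynomial σ ℝ≥0} (hq : q ≠ 0) : eval (fun _ => (1 : ℝ≥0)) q ≠ 0 := by
  classical
  rw [eval_eq]
  simp only [one_pow, Finset.prod_const_one, mul_one]
  intro h
  rw [Finset.sum_eq_zero_iff] at h
  obtain ⟨d, hd⟩ := support_nonempty.2 hq
  exact (mem_support_iff.1 hd) (h d hd)

/-- A substitution sending every variable to itself or to `1` does not change the value at the all-ones point.
[folklore] -/
theorem eval_one_aeval_of_X_or_one (a : σ → MvPolynomial σ ℝ≥0) (ha : ∀ e, a e = X e ∨ a e = 1)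
    (q : MvPolynomial σ ℝ≥0) :
    eval (fun _ => (1 : ℝ≥0)) (aeval a q) = eval (fun _ => (1 : ℝ≥0)) q := by
  have key : (eval fun _ => (1 : ℝ≥0)).comp
      (aeval a : MvPolynomial σ ℝ≥0 →ₐ[ℝ≥0] MvPolynomial σ ℝ≥0).toRingHom = eval fun _ => (1 : ℝ≥0) := by
    refine ringHom_ext (fun r => ?_) (fun i => ?_)
    · simp
    · simp only [RingHom.coe_comp, Function.comp_apply, AlgHom.toRingHom_eq_coe, AlgHom.coe_toRingHom,
        aeval_X]
      rcases ha i with h | h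
      · rw [h]
      · rw [h, map_one, eval_X]
  exact RingHom.congr_fun key q

/-- Such a substitution does not kill a nonzero polynomial over `ℝ≥0`. [folklore] -/
theorem aeval_ne_zero_of_X_or_one (a : σ → MvPolynomial σ ℝ≥0) (ha : ∀ e, a e = X e ∨ a e = 1)
    {q : MvPolynomial σ ℝ≥0} (hq : q ≠ 0) : aeval a q ≠ 0 := by
  intro h
  have key := eval_one_aeval_of_X_or_one a ha q
  rw [h, map_zero] at key
  exact eval_one_ne_zero hq key.symm

/-- Such a substitution is a projection, hence free (Bürgisser 2000, Rem. 2.7). [cite: Burgisser2000, Rem. 2.7] -/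
theorem complexity_aeval_le_of_X_or_one (a : σ → MvPolynomial σ ℝ≥0) (ha : ∀ e, a e = X e ∨ a e = 1)
    (q : MvPolynomial σ ℝ≥0) : complexity (aeval a q) ≤ complexity q :=
  complexity_le_of_isProjection
    ⟨a, fun e => (ha e).imp (fun h => ⟨e, h⟩) (fun h => ⟨1, by rw [h, C_1]⟩), rfl⟩

/-- The variables of the substituted polynomial are among the kept ones. [folklore] -/
theorem vars_aeval_subset (K : Set σ) (a : σ → MvPolynomial σ ℝ≥0)
    (hK : ∀ e, e ∈ K → a e = X e) (hK' : ∀ e, e ∉ K → a e = 1) (q : MvPolynomial σ ℝ≥0) :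
    (↑(aeval a q).vars : Set σ) ⊆ K := by
  classical
  intro e he
  rw [Finset.mem_coe, show aeval a q = bind₁ a q by rw [aeval_eq_bind₁]] at he
  obtain ⟨i, -, hi⟩ := Finset.mem_biUnion.1 (vars_bind₁ a q he)
  by_cases hiK : i ∈ K
  · rw [hK i hiK, vars_X, Finset.mem_singleton] at hi
    rw [hi]
    exact hiK
  · rw [hK' i hiK, vars_one] at hi
    exact absurd hi (Finset.notMem_empty _)

/-- A polynomial none of whose monomials touches a kept variable is sent to the constant «sum of its coefficients».
[folklore] -/
theorem aeval_eq_C_of_support (K : Set σ) (a : σ → MvPolynomial σ ℝ≥0)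
    (hK' : ∀ e, e ∉ K → a e = 1) {S : MvPolynomial σ ℝ≥0}
    (hS : ∀ m ∈ S.support, ∀ e ∈ m.support, e ∉ K) :
    aeval a S = C (eval (fun _ => (1 : ℝ≥0)) S) := by
  classical
  conv_lhs => rw [S.as_sum]
  rw [map_sum, eval_eq]
  simp only [one_pow, Finset.prod_const_one, mul_one, map_sum]
  refine Finset.sum_congr rfl fun m hm => ?_
  rw [aeval_monomial, Finsupp.prod,
    Finset.prod_eq_one (fun i hi => by rw [hK' i (hS m hm i hi), one_pow]), mul_one, algebraMap_eq]

/-- The substitution fixes every polynomial in the kept variables `ι(Q)`. [folklore] -/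
theorem aeval_rename_of_kept {τ : Type*} (ι : τ → σ) (a : σ → MvPolynomial σ ℝ≥0)
    (hK : ∀ t, a (ι t) = X (ι t)) (Q : MvPolynomial τ ℝ≥0) : aeval a (rename ι Q) = rename ι Q := by
  rw [aeval_rename, show (a ∘ ι) = (X ∘ ι) from funext fun t => hK t]
  exact DFunLike.congr_fun (algHom_ext fun t => by simp : aeval (X ∘ ι) = rename ι) Q

end PartialEval

/-! ### §2 Abstract linear transport -/

/-- ★★ **ABSTRACT LINEAR TRANSPORT.**  Let `ι : τ → σ` be an injective renaming of variables, `w` a weight on `σ`,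
and suppose the `w`-top face of `P` splits as `top_w P = ι(Q) · S` with `S ≠ 0` and no monomial of `S` touching a
variable in the range of `ι`.  Then every certificate for `P` restricts to one for `Q` at ADDITIVE cost: for every `h ≠ 0`
there is `g ≠ 0` with `L₊(Q · g) ≤ L₊(P · h) + 1` and `L₊(g) ≤ L₊(h)` (top components are free and multiplicative over
`ℝ≥0`; substitute `1` for the variables off the range of `ι` — a projection, free; `S` becomes a positive constant; rename
back). [cite: Burgisser2000, Rem. 2.7] -/
theorem linear_transport {σ τ : Type*} {ι : τ → σ} (hι : Function.Injective ι) (w : σ → ℕ)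
    {P S : MvPolynomial σ ℝ≥0} {Q : MvPolynomial τ ℝ≥0}
    (hface : topComponent w P = rename ι Q * S) (hS0 : S ≠ 0)
    (hS : ∀ m ∈ S.support, ∀ e ∈ m.support, e ∉ Set.range ι)
    {h : MvPolynomial σ ℝ≥0} (hh : h ≠ 0) :
    ∃ g : MvPolynomial τ ℝ≥0, g ≠ 0 ∧
      complexity (Q * g) ≤ complexity (P * h) + 1 ∧ complexity g ≤ complexity h := by
  classical
  let a : σ → MvPolynomial σ ℝ≥0 := fun e => if e ∈ Set.range ι then X e else 1
  have hK : ∀ e, e ∈ Set.range ι → a e = X e := fun e he => by simp only [a, if_pos he]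
  have hK' : ∀ e, e ∉ Set.range ι → a e = 1 := fun e he => by simp only [a, if_neg he]
  have ha : ∀ e, a e = X e ∨ a e = 1 := fun e => by
    by_cases he : e ∈ Set.range ι
    · exact Or.inl (hK e he)
    · exact Or.inr (hK' e he)
  have hKι : ∀ t, a (ι t) = X (ι t) := fun t => hK _ ⟨t, rfl⟩
  have hq : topComponent w h ≠ 0 := topComponent_ne_zero w hh
  have hG0 : aeval a (topComponent w h) ≠ 0 := aeval_ne_zero_of_X_or_one a ha hq
  obtain ⟨g, hg⟩ := exists_rename_eq_of_vars_subset_range (aeval a (topComponent w h)) ι hι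
    (vars_aeval_subset (Set.range ι) a hK hK' _)
  have hren : ∀ R : MvPolynomial τ ℝ≥0, complexity (rename ι R) = complexity R :=
    fun R => complexity_rename_of_injective_holds hι R
  refine ⟨g, ?_, ?_, ?_⟩
  · rintro rfl
    rw [map_zero] at hg
    exact hG0 hg.symm
  · have hκ : eval (fun _ => (1 : ℝ≥0)) S ≠ 0 := eval_one_ne_zero hS0
    have hSC : aeval a S = C (eval (fun _ => (1 : ℝ≥0)) S) := aeval_eq_C_of_support (Set.range ι) a hK' hS
    have H1 : complexity (aeval a (topComponent w (P * h))) ≤ complexity (P * h) :=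
      (complexity_aeval_le_of_X_or_one a ha _).trans (complexity_topComponent_le w _)
    have H2 : aeval a (topComponent w (P * h)) =
        rename ι (C (eval (fun _ => (1 : ℝ≥0)) S) * (Q * g)) := by
      rw [topComponent_mul, hface, map_mul, map_mul, aeval_rename_of_kept ι a hKι, hSC, ← hg, map_mul, map_mul,
        rename_C]
      ring
    rw [H2, hren] at H1
    have H3 : Q * g = C (eval (fun _ => (1 : ℝ≥0)) S)⁻¹ * (C (eval (fun _ => (1 : ℝ≥0)) S) * (Q * g)) := by
      rw [← mul_assoc, ← C_mul, inv_mul_cancel₀ hκ, C_1, one_mul]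
    calc complexity (Q * g)
        = complexity (C (eval (fun _ => (1 : ℝ≥0)) S)⁻¹ * (C (eval (fun _ => (1 : ℝ≥0)) S) * (Q * g))) := by
          rw [← H3]
      _ ≤ complexity (C (eval (fun _ => (1 : ℝ≥0)) S)⁻¹ : MvPolynomial τ ℝ≥0) +
            complexity (C (eval (fun _ => (1 : ℝ≥0)) S) * (Q * g)) + 1 := complexity_mul_le_holds _ _
      _ = complexity (C (eval (fun _ => (1 : ℝ≥0)) S) * (Q * g)) + 1 := by rw [complexity_C_holds, zero_add]
      _ ≤ complexity (P * h) + 1 := by gcongr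
  · calc complexity g = complexity (rename ι g) := (hren g).symm
      _ = complexity (aeval a (topComponent w h)) := by rw [hg]
      _ ≤ complexity (topComponent w h) := complexity_aeval_le_of_X_or_one a ha _
      _ ≤ complexity h := complexity_topComponent_le w h

/-! ### §3 The pinned rainbow instance: linear-cost universal transport -/

variable {n a : ℕ}

/-- The pin arcs lie outside the left block: no variable of `x^{pins}` is in the range of the block embedding.
[folklore] -/
theorem pinExp_support_outside (hle : 2 * a ≤ 2 * n) :
    ∀ m ∈ (monomial (pinExp n a) (1 : ℝ≥0)).support, ∀ e ∈ m.support, e ∉ Set.range (blockEmb hle) := by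
  classical
  intro m hm e he
  rw [support_monomial, if_neg one_ne_zero, Finset.mem_singleton] at hm
  subst hm
  simp only [pinExp] at he
  obtain ⟨p, hp, he'⟩ := Finset.mem_biUnion.1 (Finsupp.support_finsetSum he)
  obtain ⟨rfl, -⟩ := Finsupp.mem_support_single _ _ _ |>.1 he'
  simp only [pinOpeners, Finset.mem_filter, Finset.mem_univ, true_and] at hp
  rintro ⟨⟨i, j⟩, hij⟩
  have hv := congrArg (fun x : Fin (2 * n) × Fin (2 * n) => (x.1 : ℕ)) hij
  simp only [blockEmb, Prod.map_fst, Fin.val_castLE] at hv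
  have := i.isLt
  omega

/-- ★★ **LINEAR-COST UNIVERSAL TRANSPORT.**  For `4a+2 ≤ 2n`, `n ≤ 3a+1` and EVERY cofactor `h ≠ 0` there is a nonzero
`f` on the arcs of the left block `[0, 2a)` with `L₊(NN_a · f) ≤ L₊(NN_n · h) + 1` and `L₊(f) ≤ L₊(h)` (pinned rainbow
top, then `x_e ↦ 1` off the block: `x^{pins} ↦ 1`, `ι(NN_a)` fixed).  Improves `UniversalTransport.exists_transport`
(`16((2n+1)(L+1))²`). [cite: Burgisser2000, Rem. 2.7] [cite: JuknaSeiwertSergeev2022, Thm 1] -/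
theorem exists_transport_linear (h1 : 4 * a + 2 ≤ 2 * n) (h2 : n ≤ 3 * a + 1) (hle : 2 * a ≤ 2 * n)
    {h : MvPolynomial (Fin (2 * n) × Fin (2 * n)) ℝ≥0} (hh : h ≠ 0) :
    ∃ f : MvPolynomial (Fin (2 * a) × Fin (2 * a)) ℝ≥0, f ≠ 0 ∧
      complexity (nestFreeMatchingPoly a ℝ≥0 * f) ≤ complexity (nestFreeMatchingPoly n ℝ≥0 * h) + 1 ∧
      complexity f ≤ complexity h :=
  linear_transport (blockEmb_injective hle) (prWeight n a)
    ((topComponent_eq h1 h2 hle).trans (mul_comm _ _)) (monomial_eq_zero.not.2 one_ne_zero)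
    (pinExp_support_outside hle) hh

/-- ★★ **LINEAR-COST TRANSPORT at the canonical block size** `a = ⌊(n+2)/3⌋` (`n ≥ 7`).
[cite: Burgisser2000, Rem. 2.7] [cite: JuknaSeiwertSergeev2022, Thm 1] -/
theorem exists_transport_linear_third {n : ℕ} (hn : 7 ≤ n)
    {h : MvPolynomial (Fin (2 * n) × Fin (2 * n)) ℝ≥0} (hh : h ≠ 0) :
    ∃ f : MvPolynomial (Fin (2 * ((n + 2) / 3)) × Fin (2 * ((n + 2) / 3))) ℝ≥0, f ≠ 0 ∧
      complexity (nestFreeMatchingPoly ((n + 2) / 3) ℝ≥0 * f) ≤ complexity (nestFreeMatchingPoly n ℝ≥0 * h) + 1 ∧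
      complexity f ≤ complexity h :=
  exists_transport_linear (by omega) (by omega) (by omega) hh

/-! ### §4 The transported cofactor: variable control -/

/-- ★ **LINEAR TRANSPORT WITH VARIABLE CONTROL.**  As `linear_transport`, recording what the transported cofactor `g`
is made of (it is `g = ι^*(h^{top}|_{x_e := 1, e ∉ range ι})`, `h^{top}` the `w`-top component of `h`): (i) every
variable of `g` is the `ι`-preimage of a variable of `h`; (ii) if NO variable of `h` lies in the range of `ι`, then `g`
is a nonzero CONSTANT — so `L₊(Q) ≤ L₊(P · h) + 2` (`complexity_le_of_vars_outside`). [cite: Burgisser2000, Rem. 2.7] -/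
theorem linear_transport_vars {σ τ : Type*} {ι : τ → σ} (hι : Function.Injective ι) (w : σ → ℕ)
    {P S : MvPolynomial σ ℝ≥0} {Q : MvPolynomial τ ℝ≥0}
    (hface : topComponent w P = rename ι Q * S) (hS0 : S ≠ 0)
    (hS : ∀ m ∈ S.support, ∀ e ∈ m.support, e ∉ Set.range ι)
    {h : MvPolynomial σ ℝ≥0} (hh : h ≠ 0) :
    ∃ g : MvPolynomial τ ℝ≥0, g ≠ 0 ∧
      complexity (Q * g) ≤ complexity (P * h) + 1 ∧ complexity g ≤ complexity h ∧
      (∀ t ∈ g.vars, ι t ∈ h.vars) ∧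
      ((∀ e ∈ h.vars, e ∉ Set.range ι) → ∃ κ : ℝ≥0, κ ≠ 0 ∧ g = C κ) := by
  classical
  let a : σ → MvPolynomial σ ℝ≥0 := fun e => if e ∈ Set.range ι then X e else 1
  have hK : ∀ e, e ∈ Set.range ι → a e = X e := fun e he => by simp only [a, if_pos he]
  have hK' : ∀ e, e ∉ Set.range ι → a e = 1 := fun e he => by simp only [a, if_neg he]
  have ha : ∀ e, a e = X e ∨ a e = 1 := fun e => by
    by_cases he : e ∈ Set.range ι
    · exact Or.inl (hK e he)
    · exact Or.inr (hK' e he)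
  have hKι : ∀ t, a (ι t) = X (ι t) := fun t => hK _ ⟨t, rfl⟩
  have hq : topComponent w h ≠ 0 := topComponent_ne_zero w hh
  have hG0 : aeval a (topComponent w h) ≠ 0 := aeval_ne_zero_of_X_or_one a ha hq
  have hsub := Summit.ValiantsHypothesis.ValiantsHypothesis.Theorems.ZeroOneTransfer.Negative.support_topComponent_subset w h
  obtain ⟨g, hg⟩ := exists_rename_eq_of_vars_subset_range (aeval a (topComponent w h)) ι hι
    (vars_aeval_subset (Set.range ι) a hK hK' _)
  have hren : ∀ R : MvPolynomial τ ℝ≥0, complexity (rename ι R) = complexity R :=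
    fun R => complexity_rename_of_injective_holds hι R
  refine ⟨g, ?_, ?_, ?_, ?_, ?_⟩
  · rintro rfl
    rw [map_zero] at hg
    exact hG0 hg.symm
  · have hκ : eval (fun _ => (1 : ℝ≥0)) S ≠ 0 := eval_one_ne_zero hS0
    have hSC : aeval a S = C (eval (fun _ => (1 : ℝ≥0)) S) := aeval_eq_C_of_support (Set.range ι) a hK' hS
    have H1 : complexity (aeval a (topComponent w (P * h))) ≤ complexity (P * h) :=
      (complexity_aeval_le_of_X_or_one a ha _).trans (complexity_topComponent_le w _)
    have H2 : aeval a (topComponent w (P * h)) =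
        rename ι (C (eval (fun _ => (1 : ℝ≥0)) S) * (Q * g)) := by
      rw [topComponent_mul, hface, map_mul, map_mul, aeval_rename_of_kept ι a hKι, hSC, ← hg, map_mul, map_mul,
        rename_C]
      ring
    rw [H2, hren] at H1
    have H3 : Q * g = C (eval (fun _ => (1 : ℝ≥0)) S)⁻¹ * (C (eval (fun _ => (1 : ℝ≥0)) S) * (Q * g)) := by
      rw [← mul_assoc, ← C_mul, inv_mul_cancel₀ hκ, C_1, one_mul]
    calc complexity (Q * g)
        = complexity (C (eval (fun _ => (1 : ℝ≥0)) S)⁻¹ * (C (eval (fun _ => (1 : ℝ≥0)) S) * (Q * g))) := by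
          rw [← H3]
      _ ≤ complexity (C (eval (fun _ => (1 : ℝ≥0)) S)⁻¹ : MvPolynomial τ ℝ≥0) +
            complexity (C (eval (fun _ => (1 : ℝ≥0)) S) * (Q * g)) + 1 := complexity_mul_le_holds _ _
      _ = complexity (C (eval (fun _ => (1 : ℝ≥0)) S) * (Q * g)) + 1 := by rw [complexity_C_holds, zero_add]
      _ ≤ complexity (P * h) + 1 := by gcongr
  · calc complexity g = complexity (rename ι g) := (hren g).symm
      _ = complexity (aeval a (topComponent w h)) := by rw [hg]
      _ ≤ complexity (topComponent w h) := complexity_aeval_le_of_X_or_one a ha _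
      _ ≤ complexity h := complexity_topComponent_le w h
  · intro t ht
    obtain ⟨d, hd, htd⟩ := (mem_vars_iff_mem_support t).1 ht
    have h1 : Finsupp.mapDomain ι d ∈ (rename ι g).support := by
      rw [support_rename_of_injective hι]
      exact Finset.mem_image_of_mem _ hd
    have h2 : ι t ∈ (Finsupp.mapDomain ι d).support := by
      rw [Finsupp.mem_support_iff, Finsupp.mapDomain_apply hι]
      exact Finsupp.mem_support_iff.1 htd
    have h3 : ι t ∈ (bind₁ a (topComponent w h)).vars := by
      rw [← aeval_eq_bind₁, ← hg]
      exact (mem_vars_iff_mem_support _).2 ⟨_, h1, h2⟩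
    obtain ⟨i, hi, hi'⟩ := Finset.mem_biUnion.1 (vars_bind₁ a _ h3)
    have hi_eq : i = ι t := by
      by_cases hiK : i ∈ Set.range ι
      · rw [hK i hiK, vars_X, Finset.mem_singleton] at hi'
        exact hi'.symm
      · rw [hK' i hiK, vars_one] at hi'
        exact absurd hi' (Finset.notMem_empty _)
    rw [hi_eq] at hi
    obtain ⟨d', hd', hd''⟩ := (mem_vars_iff_mem_support _).1 hi
    exact (mem_vars_iff_mem_support _).2 ⟨d', hsub hd', hd''⟩
  · intro havoid
    have htop : ∀ m ∈ (topComponent w h).support, ∀ e ∈ m.support, e ∉ Set.range ι :=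
      fun m hm e he => havoid e ((mem_vars_iff_mem_support e).2 ⟨m, hsub hm, he⟩)
    have hC : aeval a (topComponent w h) = C (eval (fun _ => (1 : ℝ≥0)) (topComponent w h)) :=
      aeval_eq_C_of_support (Set.range ι) a hK' htop
    refine ⟨eval (fun _ => (1 : ℝ≥0)) (topComponent w h), eval_one_ne_zero hq, rename_injective ι hι ?_⟩
    rw [hg, hC, rename_C]

/-- ★ **COFACTORS AVOIDING THE BLOCK.**  In the situation of `linear_transport`, if no variable of the cofactor `h` lies
in the range of `ι`, then `L₊(Q) ≤ L₊(P · h) + 2`: the face factor `Q` itself is almost as cheap as the certificate.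
[cite: Burgisser2000, Rem. 2.7] -/
theorem complexity_le_of_vars_outside {σ τ : Type*} {ι : τ → σ} (hι : Function.Injective ι) (w : σ → ℕ)
    {P S : MvPolynomial σ ℝ≥0} {Q : MvPolynomial τ ℝ≥0}
    (hface : topComponent w P = rename ι Q * S) (hS0 : S ≠ 0)
    (hS : ∀ m ∈ S.support, ∀ e ∈ m.support, e ∉ Set.range ι)
    {h : MvPolynomial σ ℝ≥0} (hh : h ≠ 0) (havoid : ∀ e ∈ h.vars, e ∉ Set.range ι) :
    complexity Q ≤ complexity (P * h) + 2 := by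
  obtain ⟨g, -, hb, -, -, hconst⟩ := linear_transport_vars hι w hface hS0 hS hh
  obtain ⟨κ, hκ, rfl⟩ := hconst havoid
  have H3 : Q = C κ⁻¹ * (Q * C κ) := by
    rw [mul_comm Q, ← mul_assoc, ← C_mul, inv_mul_cancel₀ hκ, C_1, one_mul]
  calc complexity Q = complexity (C κ⁻¹ * (Q * C κ)) := by rw [← H3]
    _ ≤ complexity (C κ⁻¹ : MvPolynomial τ ℝ≥0) + complexity (Q * C κ) + 1 := complexity_mul_le_holds _ _
    _ = complexity (Q * C κ) + 1 := by rw [complexity_C_holds, zero_add]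
    _ ≤ complexity (P * h) + 1 + 1 := by gcongr
    _ = complexity (P * h) + 2 := rfl

end Summit.ValiantsHypothesis.ValiantsHypothesis.Theorems.FifoMatching.NNDivisionHard.LinearTransport

end
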